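import Summits.QuantumFields.YangMills.Theses.BalabanUVNodes

/-!
# CRIT-1 g32 — 27929 `PortResummationU5b`: signature of record (v1) and the level-UNIFORM upgrade target (v2)

* `Sig27929v1` = the signature SET on stmt-QuantumFields-27929 at 2026-08-30T19:23:16Z (sha16 of the ledger text
  9fb1a40827d36626; = lens-2 g2 `PortResummationU5bSig`, HOME `nodeO-cover/LENS-2-PortSignatures-v0.lean` 91e18b6f02e609c4 §1,
  with FQNs). Constants `ε₀, K` are chosen AFTER the geometry `(α, inc, ℓ)` and the scalars.
* `Sig27929v2` = REF n220's point made a type: `ε₀, K` chosen from the scalars `(c₀, b, N, κ, κ')` BEFORE the geometry —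
  hence uniform over the renormalisation LEVEL k (each level is a different `(α, ℓ) = (cubes of T^(k), d_k)` with the same
  scalars), which is what PT-F's ½E₀ bookkeeping consumes. The proof road of my critic sheet (STATUS l.3377 (6)) proves v2 as
  it stands: `ε₀ := e^(−1−κ'c₀)/N`, `K := N·e·(c₀+1)` for `N > 0`; for `N ≤ 0` the entropy antecedent is unsatisfiable
  (the `A' = A` term, reflexivity) so `ε₀ := 1, K := 0` serve vacuously.
* `sig27929_v2_imp_v1` : v2 → v1 (pure logic, kernel-checked) — a porter who proves v2 closes the item (v1) in three lines
  and leaves the uniform form in the tree. ADVISORY: the item's signature of record stays v1 (№419); this file re-sets nothing.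
* rule (N): the lens-2 toy `(Unit, polyInc, ℓ = 0, c₀ = b = 0, N = 2, κ = 1, κ' = 0)` instantiates every antecedent of v2.

HONEST: statement texts and one implication between them; no inhabitant of either; nothing of Bałaban asserted; K0⁷ open;
COUNT 8∕28 · K 1∕4 unmoved; the Yang–Mills mass gap (Clay) is NOT proved by any of this.
-/

namespace Summit.QuantumFields.YangMills.Cruxes.Record13SepCoPHInhabited.Crit1Sig27929

/-- Signature of record on stmt-QuantumFields-27929 (v1; ledger text sha16 9fb1a40827d36626). -/
def Sig27929v1 : Prop :=
  ∀ (α : Type) [DecidableEq α] [Countable α] (inc : Finset α → Finset α → Prop) [DecidableRel inc] [Std.Refl inc] [Std.Symm inc], (∀ A B : Finset α, (A ∩ B).Nonempty → inc A B) → ∀ (ℓ : Finset α → ℝ) (c₀ b N : ℝ), (∀ A, 0 ≤ ℓ A) → 0 ≤ c₀ → (∀ x : α, ℓ {x} ≤ c₀) → (∀ C : Finset (Finset α), C.Nonempty → Literature.Probability.LatticeModels.IsPolymerCluster inc C → ℓ (Literature.Probability.LatticeModels.clusterSupp C) + c₀ ≤ ∑ A ∈ C, (ℓ A + c₀)) →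 (∀ A : Finset α, Summable (fun A' : {A' : Finset α // inc A' A} => Real.exp (-b * ℓ (A' : Finset α))) ∧ ∑' A' : {A' : Finset α // inc A' A}, Real.exp (-b * ℓ (A' : Finset α)) ≤ N * (ℓ A + 1)) → ∀ (κ κ' : ℝ), 0 ≤ κ' → κ' + b + 1 ≤ κ → ∃ ε₀ : ℝ, 0 < ε₀ ∧ ∃ K : ℝ, 0 ≤ K ∧ ∀ (H : Finset α → ℂ) (ε : ℝ), 0 ≤ ε → ε ≤ ε₀ → (∀ A, ‖H A‖ ≤ ε * Real.exp (-κ * ℓ A)) → ∀ (𝒱 : Finset (Finset α)) (X : Finset α), X.Nonempty → ‖∑ C ∈ 𝒱.powerset with Literature.Probability.LatticeModels.clusterSupp C = X, Literature.Probability.LatticeModels.truncatedWeight inc H C‖ ≤ K * ε * Real.exp (-κ' * ℓ X)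

/-- Level-uniform upgrade target (v2, REF n220): `∃ ε₀ K` before `∀ α inc ℓ`. -/
def Sig27929v2 : Prop :=
  ∀ (c₀ b N κ κ' : ℝ), 0 ≤ c₀ → 0 ≤ κ' → κ' + b + 1 ≤ κ → ∃ ε₀ : ℝ, 0 < ε₀ ∧ ∃ K : ℝ, 0 ≤ K ∧ ∀ (α : Type) [DecidableEq α] [Countable α] (inc : Finset α → Finset α → Prop) [DecidableRel inc] [Std.Refl inc] [Std.Symm inc], (∀ A B : Finset α, (A ∩ B).Nonempty → inc A B) → ∀ (ℓ : Finset α → ℝ), (∀ A, 0 ≤ ℓ A) → (∀ x : α, ℓ {x} ≤ c₀) → (∀ C : Finset (Finset α), C.Nonempty → Literature.Probability.LatticeModels.IsPolymerCluster inc C → ℓ (Literature.Probability.LatticeModels.clusterSupp C) + c₀ ≤ ∑ A ∈ C, (ℓ A + c₀)) → (∀ A : Finset α, Summable (fun A' : {A' : Finset α // inc A' A} => Real.exp (-b * ℓ (A' : Finset α))) ∧ ∑' A' : {A' : Finset α // inc A' A}, Real.exp (-b * ℓ (A' : Finset α)) ≤ N * (ℓ A + 1)) → ∀ (H : Finset α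 → ℂ) (ε : ℝ), 0 ≤ ε → ε ≤ ε₀ → (∀ A, ‖H A‖ ≤ ε * Real.exp (-κ * ℓ A)) → ∀ (𝒱 : Finset (Finset α)) (X : Finset α), X.Nonempty → ‖∑ C ∈ 𝒱.powerset with Literature.Probability.LatticeModels.clusterSupp C = X, Literature.Probability.LatticeModels.truncatedWeight inc H C‖ ≤ K * ε * Real.exp (-κ' * ℓ X)

/-- v2 ⟹ v1: the uniform form is the stronger statement. [folklore] -/
theorem sig27929_v2_imp_v1 (h : Sig27929v2) : Sig27929v1 := by
  intro α _ _ inc _ _ _ hshare ℓ c₀ b N hℓ hc₀ hx h27 h29 κ κ' hκ' hκ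
  obtain ⟨ε₀, hε₀, K, hK, hall⟩ := h c₀ b N κ κ' hc₀ hκ' hκ
  exact ⟨ε₀, hε₀, K, hK, fun H ε hε hεε hH 𝒱 X hX => hall α inc hshare ℓ hℓ hx h27 h29 H ε hε hεε hH 𝒱 X hX⟩

/-- Rule (N) for v2: every antecedent is met by the lens-2 toy `(Unit, polyInc, ℓ = 0, c₀ = b = 0, N = 2, κ = 1, κ' = 0)`,
so v2 is not vacuously quantified. [folklore] -/
example (h : Sig27929v2) :
    ∃ ε₀ : ℝ, 0 < ε₀ ∧ ∃ K : ℝ, 0 ≤ K ∧ ∀ (H : Finset Unit → ℂ) (ε : ℝ), 0 ≤ ε → ε ≤ ε₀ →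
      (∀ A, ‖H A‖ ≤ ε * Real.exp (-(1 : ℝ) * (0 : ℝ))) →
      ∀ (𝒱 : Finset (Finset Unit)) (X : Finset Unit), X.Nonempty →
        ‖∑ C ∈ 𝒱.powerset with Literature.Probability.LatticeModels.clusterSupp C = X,
            Literature.Probability.LatticeModels.truncatedWeight Literature.Probability.LatticeModels.polyInc H C‖ ≤
          K * ε * Real.exp (-(0 : ℝ) * (0 : ℝ)) := by
  obtain ⟨ε₀, hε₀, K, hK, hall⟩ := h 0 0 2 1 0 le_rfl le_rfl (by norm_num)
  refine ⟨ε₀, hε₀, K, hK, fun H ε hε hεε hH 𝒱 X hX => ?_⟩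
  have hshare : ∀ A B : Finset Unit, (A ∩ B).Nonempty → Literature.Probability.LatticeModels.polyInc A B :=
    fun A B hAB => Or.inr hAB
  have h27 : ∀ C : Finset (Finset Unit), C.Nonempty →
      Literature.Probability.LatticeModels.IsPolymerCluster Literature.Probability.LatticeModels.polyInc C →
      (fun _ : Finset Unit => (0 : ℝ)) (Literature.Probability.LatticeModels.clusterSupp C) + 0 ≤
        ∑ A ∈ C, ((fun _ : Finset Unit => (0 : ℝ)) A + 0) := by
    intro C _ _; simp
  have h29 : ∀ A : Finset Unit,
      Summable (fun A' : {A' : Finset Unit // Literature.Probability.LatticeModels.polyInc A' A} =>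
        Real.exp (-(0 : ℝ) * (fun _ : Finset Unit => (0 : ℝ)) (A' : Finset Unit))) ∧
      ∑' A' : {A' : Finset Unit // Literature.Probability.LatticeModels.polyInc A' A},
        Real.exp (-(0 : ℝ) * (fun _ : Finset Unit => (0 : ℝ)) (A' : Finset Unit)) ≤ 2 * ((fun _ : Finset Unit => (0 : ℝ)) A + 1) := by
    intro A
    haveI : Fintype {A' : Finset Unit // Literature.Probability.LatticeModels.polyInc A' A} := Fintype.ofFinite _
    refine ⟨(hasSum_fintype _).summable, ?_⟩
    rw [tsum_fintype]
    simp only [neg_zero, zero_mul, Real.exp_zero, Finset.sum_const, Finset.card_univ, nsmul_eq_mul, mul_one, zero_add]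
    have hcard : Fintype.card {A' : Finset Unit // Literature.Probability.LatticeModels.polyInc A' A} ≤ 2 := by
      calc Fintype.card {A' : Finset Unit // Literature.Probability.LatticeModels.polyInc A' A}
          ≤ Fintype.card (Finset Unit) := Fintype.card_subtype_le _
        _ = 2 := by simp
    exact_mod_cast hcard
  exact hall Unit Literature.Probability.LatticeModels.polyInc hshare (fun _ => 0) (fun _ => le_rfl) (fun _ => le_rfl)
    h27 h29 H ε hε hεε hH 𝒱 X hX

/-- `N > 0` is forced by the entropy antecedent through reflexivity (the `A' = A` term). [folklore] -/
theorem entropy_forces_pos {α : Type} (inc : Finset α → Finset α → Prop) [Std.Refl inc] (ℓ : Finset α → ℝ) (b N : ℝ)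
    (A : Finset α)
    (hs : Summable (fun A' : {A' : Finset α // inc A' A} => Real.exp (-b * ℓ (A' : Finset α))))
    (hN : ∑' A' : {A' : Finset α // inc A' A}, Real.exp (-b * ℓ (A' : Finset α)) ≤ N * (ℓ A + 1)) :
    0 < N * (ℓ A + 1) := by
  have hmem : inc A A := Std.Refl.refl A
  have h1 : Real.exp (-b * ℓ A) ≤ ∑' A' : {A' : Finset α // inc A' A}, Real.exp (-b * ℓ (A' : Finset α)) :=
    hs.le_tsum (⟨A, hmem⟩ : {A' : Finset α // inc A' A}) (fun _ _ => (Real.exp_pos _).le)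
  exact lt_of_lt_of_le (lt_of_lt_of_le (Real.exp_pos _) h1) hN

end Summit.QuantumFields.YangMills.Cruxes.Record13SepCoPHInhabited.Crit1Sig27929
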